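import Literature.MathematicalPhysics.QuantumFieldTheory.Balaban1983to89.B9Eq3101ConjugationLettersCurl

/-!
# `Balaban1983to89.B9Eq3101ConjugationLettersTwoBackgrounds` — T. Bałaban, *Propagators for lattice gauge theories in a background field*, Commun. Math.
# Phys. **99** (1985) 389–434 [Balaban1985BackgroundPropagators] (3.4) p. 391, (3.8) p. 392, (3.49) p. 399, (3.52)–(3.53) p. 400, (3.70)–(3.73) pp. 404–405,
# (3.101)–(3.103) p. 414: **THE CONJUGATED TWO-BACKGROUND LETTERS OF THE CURL AND OF THE DIVERGENCE — «CONJUGATE THE DIFFERENCE»: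
# `‖e^{κχ}(curl_R − curl_{R′})e^{−κχ}A‖ ≤ 2‖c‖·e^{‖κ‖θ}·δ_T·d·‖A‖`, `‖e^{κχ}(D*_S − D*_{S′})e^{−κχ}A‖ ≤ ‖c‖·e^{‖κ‖θ}·δ_T·√d·‖A‖` for transporter data
# `δ_T`-close on the fibre** — the difference of two covariant curls (divergences) has NO untransported term, so it is a ZEROTH-order multiplication-type
# operator of size `‖c‖δ_T` (`= η⁻¹·O(δη) = O(δ)` on the chain) and its conjugation costs only the factor `e^{‖κ‖θ}` (NO window)

statement-level skeleton of published theorems with citation tags; proofs where landed; nothing here is a claim about the Yang–Mills mass gap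

CITATION HEADER (lean-in-tree rule).  Audit cell `pub-balaban`, sub-cell `t4`, BINDER row NE9; filed by NE9 formalisation-swarm LEAF PROVER 01
(`b2b-balaban-t4-ne9-formalise-leaf-01`, gen 88) under the fallback offer O-leaf01-g88-2 (cell journal 2026-08-25), as the lattice suppliers of the
CONJUGATED two-background difference letters `δ₁`, `δ₂` displayed by this lineage's `B9Eq326ConjugatedDeltaATwoBackgrounds.norm_conjGk_sub_conjGk_le`
(t4-ne9-idea-1 gen 151's N52 §2 (B)(ii): «CONJUGATE THE DIFFERENCE, do not difference the conjugates: `B(U) − B(V)` is ZEROTH order … and LOCAL»).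
Imports the NE9 owner's `B9Eq3101ConjugationLettersCurl` (the one-background pattern:
identities, pointwise bounds, the plaquette ∕ site counting lemmas `sum_plaq_shift_fst_le`, `sum_plaq_shift_snd_le`, `card_dirPair_le`, `sum_site_unshift_eq`,
and `eq_symm_of_pointwise` through `…Chain`).  Sources READ first-hand in the held text layer (`paper:balaban1985-cmp99-background-propagators`, journal page =
PDF page + 388): p. 391 (3.4), p. 392 (3.8), p. 399 (3.49), p. 400 (3.52)–(3.53) *«Δ_{U′U} = Δ_U − V₁(A)»*, pp. 404–405 (3.70)–(3.73) (the first-order remainders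
between two backgrounds), p. 414 (3.101)–(3.103).  The conjugation is the ROUTE's Combes–Thomas substitute; nothing of print is asserted.

WHAT IS PROVED (sorry-free; proof lane — no `def`; [folklore] lattice bookkeeping).  Transporter data `R, R′` (resp. `S, S′`) with `‖R(b)v − R′(b)v‖ ≤ δ_T‖v‖`,
a weight `χ` with bond increments `|χ(b₋) − χ(b₊)| ≤ θ`, any `κ : ℂ`, any scalar `c`.
* §0 `norm_exp_mul_le_of_abs_le` (`‖e^{κΔ}‖ ≤ e^{‖κ‖θ}` for `|Δ| ≤ θ`).
* §1 curl: `conj_covCurl_sub_covCurl_apply` (the identity — the untransported terms CANCEL in the difference, for ANY outside ∕ inside weights `σ, ρ`),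
  `norm_conjExp_covCurl_sub_covCurl_apply_le` (pointwise), `sum_norm_sq_conjExp_covCurl_sub_covCurl_le` (`ℓ²`, function level),
  **`norm_mulOp_covCurlL2K_sub_covCurlL2K_le`** (`‖S_P(curl_R(S_B⁻¹A)) − S_P(curl_{R′}(S_B⁻¹A))‖ ≤ 2‖c‖e^{‖κ‖θ}δ_T·d·‖A‖` for abstract maps `S_P`, `S_B⁻¹`
  acting pointwise as `e^{κχ(p₀)}`, `e^{−κχ(b₋)}`).
* §2 divergence: `conj_covDiv_sub_covDiv_apply`, `norm_conjExp_covDiv_sub_covDiv_apply_le`, `sum_norm_sq_conjExp_covDiv_sub_covDiv_le`,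
  **`norm_mulOp_covDivL2K_sub_covDivL2K_le`** (`‖S_S(D*_S(S_B⁻¹A)) − S_S(D*_{S′}(S_B⁻¹A))‖ ≤ ‖c‖e^{‖κ‖θ}δ_T·√d·‖A‖`).
HONEST SCOPE.  Bookkeeping; `δ_T` displayed (on the chain `δ_T = 2M_φM_φ′·δη` by `norm_adTransportW_sub_adTransportW_le`, so `‖c‖δ_T = 2M_φM_φ′δ` at
`c = η⁻¹`); NO window on `κ` is needed (the factor is `e^{‖κ‖θ}`); the cocurl ∕ gradient twins (the `B′` sides) and the `Q`, `R(U)`, `Δ′` letters are NOT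
here.  NOT NE9 (cell pub-balaban: NE9 NOT PRINTED ∕ NOT PROVED; «NE9 ⇐ the named binders»; row WALLED ON A MODEL (O-NE9-1; #5 UNRULED); spine PROVED 0∕9;
rung (B)+1 on a finite T⁴ — NOT infinite volume, NOT mass gap, NOT BetaPertH, NOT Clay).  HONEST DEPENDENCY (cell line): continuum YM on T⁴ ⇐ BetaPertH ∧
nine spine estimates (0/9 proved); BetaPertH ⇐ (D1) ∧ (D4) ∧ CAP+tail; G-an2-4 gates asym, D1 and NE2/3/4.  NEW file; nothing modified.  Net new unproved facts: 0.
-/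

noncomputable section

open scoped BigOperators
open Finset

namespace Literature.MathematicalPhysics.QuantumFieldTheory.Balaban1983to89.B9Eq3101ConjugationLettersTwoBackgrounds

open B4Sect5Torus (TSite)
open B9SectCLatticeCarrier (Bond DirPair bpos btgt shift unshift shift_unshift unshift_shift)
open B9Eq33CovDerivVector (covDiv covDiv_apply shiftEquiv)
open B9Eq34CovCurlVector (covCurl covCurl_apply_coord)
open B9Eq311L2Pairing (WL2)
open B11Eq103H1Complex (SiteL2K BondL2K covDivL2K equiv_covDivL2K)
open B9Eq310HessianOperator (PlaqL2K covCurlL2K equiv_covCurlL2K)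
open B9Eq3101ConjugationLetters (exp_mul_exp_neg_eq_exp_sub)
open B9Eq3101ConjugationLettersChain (eq_symm_of_pointwise)
open B9Eq3101ConjugationLettersCurl (sum_plaq_shift_fst_le sum_plaq_shift_snd_le card_dirPair_le sum_site_unshift_eq)

/-! ## §0 The conjugation factor -/

/-- `|Δ| ≤ θ` ⟹ `‖e^{κΔ}‖ ≤ e^{‖κ‖θ}` — NO window. [folklore] [cite: Balaban1985BackgroundPropagators, (3.49) p.399] -/
theorem norm_exp_mul_le_of_abs_le {θ Δ : ℝ} (κ : ℂ) (hΔ : |Δ| ≤ θ) : ‖Complex.exp (κ * (Δ : ℂ))‖ ≤ Real.exp (‖κ‖ * θ) := by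
  rw [Complex.norm_exp]
  refine Real.exp_le_exp.2 ((Complex.re_le_norm _).trans ?_)
  rw [norm_mul, Complex.norm_real, Real.norm_eq_abs]
  exact mul_le_mul_of_nonneg_left hΔ (norm_nonneg κ)

/-! ## §1 The curl (3.4): the difference of two covariant curls, conjugated -/

section Curl

variable {d : ℕ} {Pd : Fin d → ℕ} {V : Type*} [NormedAddCommGroup V] [NormedSpace ℂ V]

/-- **IDENTITY.**  For ANY weights `σ, ρ` and two transporter data `R, R′` the untransported terms of (3.4) cancel in the difference:
`σ(x)(curl_R(ρA) − curl_{R′}(ρA))(p_{μν}(x)) = cσ(x)ρ(x+e_μ)·(R − R′)(x,μ)A(x+e_μ,ν) − cσ(x)ρ(x+e_ν)·(R − R′)(x,ν)A(x+e_ν,μ)`. [folklore]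
[cite: Balaban1985BackgroundPropagators, (3.4) p.391, (3.52)–(3.53) p.400, (3.70) p.404] -/
theorem conj_covCurl_sub_covCurl_apply (σ ρ : TSite d Pd → ℂ) (c : ℂ) (R R' : Bond d Pd → V →ₗ[ℂ] V) (A : Bond d Pd → V) (x : TSite d Pd) (q : DirPair d) :
    σ x • covCurl c R (fun b => ρ (bpos b) • A b) (x, q) - σ x • covCurl c R' (fun b => ρ (bpos b) • A b) (x, q) =
      (c * (σ x * ρ (shift q.1.1 x))) • (R (x, q.1.1) - R' (x, q.1.1)) (A (shift q.1.1 x, q.1.2)) -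
        (c * (σ x * ρ (shift q.1.2 x))) • (R (x, q.1.2) - R' (x, q.1.2)) (A (shift q.1.2 x, q.1.1)) := by
  simp only [covCurl_apply_coord, bpos, map_smul, smul_sub, smul_smul, LinearMap.sub_apply]
  module

/-- **IDENTITY (exponential weights):** `e^{κχ(x)}(curl_R − curl_{R′})(e^{−κχ}A)(p_{μν}(x)) = c·e^{κ(χ(x)−χ(x+e_μ))}(R − R′)(x,μ)A(x+e_μ,ν) −
c·e^{κ(χ(x)−χ(x+e_ν))}(R − R′)(x,ν)A(x+e_ν,μ)`. [folklore] [cite: Balaban1985BackgroundPropagators, (3.49) p.399, (3.4) p.391, (3.70) p.404] -/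
theorem conjExp_covCurl_sub_covCurl_apply (κ : ℂ) (χ : TSite d Pd → ℝ) (c : ℂ) (R R' : Bond d Pd → V →ₗ[ℂ] V) (A : Bond d Pd → V)
    (x : TSite d Pd) (q : DirPair d) :
    Complex.exp (κ * (χ x : ℂ)) • covCurl c R (fun b => Complex.exp (-(κ * (χ (bpos b) : ℂ))) • A b) (x, q) -
        Complex.exp (κ * (χ x : ℂ)) • covCurl c R' (fun b => Complex.exp (-(κ * (χ (bpos b) : ℂ))) • A b) (x, q) =
      (c * Complex.exp (κ * ((χ x - χ (shift q.1.1 x) : ℝ) : ℂ))) • (R (x, q.1.1) - R' (x, q.1.1)) (A (shift q.1.1 x, q.1.2)) -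
        (c * Complex.exp (κ * ((χ x - χ (shift q.1.2 x) : ℝ) : ℂ))) • (R (x, q.1.2) - R' (x, q.1.2)) (A (shift q.1.2 x, q.1.1)) := by
  rw [conj_covCurl_sub_covCurl_apply (fun x => Complex.exp (κ * (χ x : ℂ))) (fun x => Complex.exp (-(κ * (χ x : ℂ)))) c R R' A x q,
    exp_mul_exp_neg_eq_exp_sub, exp_mul_exp_neg_eq_exp_sub]

/-- **POINTWISE BOUND.**  With `|χ(b₋) − χ(b₊)| ≤ θ` on every bond and `‖R(b)v − R′(b)v‖ ≤ δ_T‖v‖`: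
`‖e^{κχ(x)}(curl_R − curl_{R′})(e^{−κχ}A)(p_{μν}(x))‖ ≤ ‖c‖e^{‖κ‖θ}δ_T·(‖A(x+e_μ,ν)‖ + ‖A(x+e_ν,μ)‖)` — NO window on `κ`. [folklore]
[cite: Balaban1985BackgroundPropagators, (3.49) p.399, (3.4) p.391, (3.70)–(3.73) pp.404–405] -/
theorem norm_conjExp_covCurl_sub_covCurl_apply_le {θ δT : ℝ} {R R' : Bond d Pd → V →ₗ[ℂ] V} (hRR' : ∀ b v, ‖R b v - R' b v‖ ≤ δT * ‖v‖) (κ : ℂ)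
    {χ : TSite d Pd → ℝ} (hχ : ∀ b : Bond d Pd, |χ (bpos b) - χ (btgt b)| ≤ θ) (c : ℂ) (A : Bond d Pd → V) (x : TSite d Pd) (q : DirPair d) :
    ‖Complex.exp (κ * (χ x : ℂ)) • covCurl c R (fun b => Complex.exp (-(κ * (χ (bpos b) : ℂ))) • A b) (x, q) -
        Complex.exp (κ * (χ x : ℂ)) • covCurl c R' (fun b => Complex.exp (-(κ * (χ (bpos b) : ℂ))) • A b) (x, q)‖ ≤
      ‖c‖ * Real.exp (‖κ‖ * θ) * δT * (‖A (shift q.1.1 x, q.1.2)‖ + ‖A (shift q.1.2 x, q.1.1)‖) := by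
  rw [conjExp_covCurl_sub_covCurl_apply]
  have e1 : ∀ μ ν : Fin d, ‖(c * Complex.exp (κ * ((χ x - χ (shift μ x) : ℝ) : ℂ))) • (R (x, μ) - R' (x, μ)) (A (shift μ x, ν))‖ ≤
      ‖c‖ * Real.exp (‖κ‖ * θ) * δT * ‖A (shift μ x, ν)‖ := fun μ ν => by
    rw [norm_smul, norm_mul, LinearMap.sub_apply]
    have h1 : ‖Complex.exp (κ * ((χ x - χ (shift μ x) : ℝ) : ℂ))‖ ≤ Real.exp (‖κ‖ * θ) := norm_exp_mul_le_of_abs_le κ (hχ (x, μ))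
    have h2 : ‖R (x, μ) (A (shift μ x, ν)) - R' (x, μ) (A (shift μ x, ν))‖ ≤ δT * ‖A (shift μ x, ν)‖ := hRR' _ _
    calc ‖c‖ * ‖Complex.exp (κ * ((χ x - χ (shift μ x) : ℝ) : ℂ))‖ * ‖R (x, μ) (A (shift μ x, ν)) - R' (x, μ) (A (shift μ x, ν))‖
        ≤ ‖c‖ * Real.exp (‖κ‖ * θ) * (δT * ‖A (shift μ x, ν)‖) :=
          mul_le_mul (mul_le_mul_of_nonneg_left h1 (norm_nonneg c)) h2 (norm_nonneg _) (mul_nonneg (norm_nonneg c) (Real.exp_pos _).le)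
      _ = ‖c‖ * Real.exp (‖κ‖ * θ) * δT * ‖A (shift μ x, ν)‖ := by ring
  calc _ ≤ ‖(c * Complex.exp (κ * ((χ x - χ (shift q.1.1 x) : ℝ) : ℂ))) • (R (x, q.1.1) - R' (x, q.1.1)) (A (shift q.1.1 x, q.1.2))‖ +
        ‖(c * Complex.exp (κ * ((χ x - χ (shift q.1.2 x) : ℝ) : ℂ))) • (R (x, q.1.2) - R' (x, q.1.2)) (A (shift q.1.2 x, q.1.1))‖ := norm_sub_le _ _
    _ ≤ ‖c‖ * Real.exp (‖κ‖ * θ) * δT * ‖A (shift q.1.1 x, q.1.2)‖ + ‖c‖ * Real.exp (‖κ‖ * θ) * δT * ‖A (shift q.1.2 x, q.1.1)‖ :=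
        add_le_add (e1 _ _) (e1 _ _)
    _ = ‖c‖ * Real.exp (‖κ‖ * θ) * δT * (‖A (shift q.1.1 x, q.1.2)‖ + ‖A (shift q.1.2 x, q.1.1)‖) := by ring

/-- **`ℓ²` BOUND, function level:** `Σ_p ‖e^{κχ}(curl_R − curl_{R′})(e^{−κχ}A)(p)‖² ≤ 4·(‖c‖e^{‖κ‖θ}δ_T)²·d²·Σ_b ‖A(b)‖²` (the plaquette counting of
`B9Eq3101ConjugationLettersCurl`). [folklore] [cite: Balaban1985BackgroundPropagators, (3.49) p.399, (3.4) p.391, (3.70)–(3.73) pp.404–405] -/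
theorem sum_norm_sq_conjExp_covCurl_sub_covCurl_le {θ δT : ℝ} {R R' : Bond d Pd → V →ₗ[ℂ] V} (hRR' : ∀ b v, ‖R b v - R' b v‖ ≤ δT * ‖v‖)
    (κ : ℂ) {χ : TSite d Pd → ℝ} (hχ : ∀ b : Bond d Pd, |χ (bpos b) - χ (btgt b)| ≤ θ) (c : ℂ) (A : Bond d Pd → V) :
    ∑ p : B9SectCLatticeCarrier.Plaq d Pd, ‖Complex.exp (κ * (χ p.1 : ℂ)) • covCurl c R (fun b => Complex.exp (-(κ * (χ (bpos b) : ℂ))) • A b) p -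
        Complex.exp (κ * (χ p.1 : ℂ)) • covCurl c R' (fun b => Complex.exp (-(κ * (χ (bpos b) : ℂ))) • A b) p‖ ^ 2 ≤
      4 * (‖c‖ * Real.exp (‖κ‖ * θ) * δT) ^ 2 * (d : ℝ) ^ 2 * ∑ b : Bond d Pd, ‖A b‖ ^ 2 := by
  set K : ℝ := ‖c‖ * Real.exp (‖κ‖ * θ) * δT with hK
  have hpt : ∀ p : B9SectCLatticeCarrier.Plaq d Pd, ‖Complex.exp (κ * (χ p.1 : ℂ)) • covCurl c R (fun b => Complex.exp (-(κ * (χ (bpos b) : ℂ))) • A b) p -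
      Complex.exp (κ * (χ p.1 : ℂ)) • covCurl c R' (fun b => Complex.exp (-(κ * (χ (bpos b) : ℂ))) • A b) p‖ ^ 2 ≤
      2 * K ^ 2 * (‖A (shift p.2.1.1 p.1, p.2.1.2)‖ ^ 2 + ‖A (shift p.2.1.2 p.1, p.2.1.1)‖ ^ 2) := by
    rintro ⟨x, q⟩
    have h := norm_conjExp_covCurl_sub_covCurl_apply_le hRR' κ hχ c A x q
    calc _ ≤ (K * (‖A (shift q.1.1 x, q.1.2)‖ + ‖A (shift q.1.2 x, q.1.1)‖)) ^ 2 := pow_le_pow_left₀ (norm_nonneg _) h 2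
      _ ≤ 2 * K ^ 2 * (‖A (shift q.1.1 x, q.1.2)‖ ^ 2 + ‖A (shift q.1.2 x, q.1.1)‖ ^ 2) := by
          nlinarith [sq_nonneg (‖A (shift q.1.1 x, q.1.2)‖ - ‖A (shift q.1.2 x, q.1.1)‖), sq_nonneg K]
  have hN := card_dirPair_le (d := d)
  have hS1 := sum_plaq_shift_fst_le (Pd := Pd) (fun b => ‖A b‖ ^ 2) (fun b => sq_nonneg _)
  have hS2 := sum_plaq_shift_snd_le (Pd := Pd) (fun b => ‖A b‖ ^ 2) (fun b => sq_nonneg _)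
  have hsum0 : 0 ≤ ∑ b : Bond d Pd, ‖A b‖ ^ 2 := Finset.sum_nonneg fun b _ => sq_nonneg _
  calc _ ≤ ∑ p : B9SectCLatticeCarrier.Plaq d Pd, 2 * K ^ 2 * (‖A (shift p.2.1.1 p.1, p.2.1.2)‖ ^ 2 + ‖A (shift p.2.1.2 p.1, p.2.1.1)‖ ^ 2) :=
        Finset.sum_le_sum fun p _ => hpt p
    _ = 2 * K ^ 2 * ((∑ p : B9SectCLatticeCarrier.Plaq d Pd, ‖A (shift p.2.1.1 p.1, p.2.1.2)‖ ^ 2) + ∑ p : B9SectCLatticeCarrier.Plaq d Pd, ‖A (shift p.2.1.2 p.1, p.2.1.1)‖ ^ 2) := by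
        rw [← Finset.sum_add_distrib, Finset.mul_sum]
    _ ≤ 2 * K ^ 2 * ((d : ℝ) ^ 2 * (∑ b : Bond d Pd, ‖A b‖ ^ 2) + (d : ℝ) ^ 2 * ∑ b : Bond d Pd, ‖A b‖ ^ 2) := by
        gcongr 2 * K ^ 2 * (?_ + ?_)
        · exact hS1.trans (mul_le_mul_of_nonneg_right hN hsum0)
        · exact hS2.trans (mul_le_mul_of_nonneg_right hN hsum0)
    _ = 4 * K ^ 2 * (d : ℝ) ^ 2 * ∑ b : Bond d Pd, ‖A b‖ ^ 2 := by ring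

end Curl

/-! ## §2 The divergence (3.8): the difference of two covariant divergences, conjugated -/

section Div

variable {d : ℕ} {Pd : Fin d → ℕ} {V : Type*} [NormedAddCommGroup V] [NormedSpace ℂ V]

/-- **IDENTITY** for (3.8): for ANY weights `σ, ρ` the `A(y,μ)` terms cancel in the difference of two covariant divergences,
`σ(y)((D*_S − D*_{S′})(ρA))(y) = c·Σ_μ σ(y)ρ(y−e_μ)·(S − S′)(y−e_μ,μ)A(y−e_μ,μ)`. [folklore] [cite: Balaban1985BackgroundPropagators, (3.8) p.392, (3.70) p.404] -/
theorem conj_covDiv_sub_covDiv_apply (σ ρ : TSite d Pd → ℂ) (c : ℂ) (S S' : Bond d Pd → V →ₗ[ℂ] V) (A : Bond d Pd → V) (y : TSite d Pd) :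
    σ y • covDiv c S (fun b => ρ (bpos b) • A b) y - σ y • covDiv c S' (fun b => ρ (bpos b) • A b) y =
      c • ∑ μ, (σ y * ρ (unshift μ y)) • (S (unshift μ y, μ) - S' (unshift μ y, μ)) (A (unshift μ y, μ)) := by
  rw [covDiv_apply, covDiv_apply, smul_comm (σ y) c, smul_comm (σ y) c, ← smul_sub, Finset.smul_sum, Finset.smul_sum, ← Finset.sum_sub_distrib]
  congr 1
  refine Finset.sum_congr rfl fun μ _ => ?_
  simp only [bpos, map_smul, smul_sub, smul_smul, LinearMap.sub_apply]
  module

/-- **POINTWISE BOUND** for (3.8): `‖e^{κχ(y)}((D*_S − D*_{S′})(e^{−κχ}A))(y)‖ ≤ ‖c‖e^{‖κ‖θ}δ_T·Σ_μ ‖A(y−e_μ,μ)‖`. [folklore]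
[cite: Balaban1985BackgroundPropagators, (3.49) p.399, (3.8) p.392, (3.70)–(3.73) pp.404–405] -/
theorem norm_conjExp_covDiv_sub_covDiv_apply_le {θ δT : ℝ} {S S' : Bond d Pd → V →ₗ[ℂ] V} (hSS' : ∀ b v, ‖S b v - S' b v‖ ≤ δT * ‖v‖) (κ : ℂ)
    {χ : TSite d Pd → ℝ} (hχ : ∀ b : Bond d Pd, |χ (bpos b) - χ (btgt b)| ≤ θ) (c : ℂ) (A : Bond d Pd → V) (y : TSite d Pd) :
    ‖Complex.exp (κ * (χ y : ℂ)) • covDiv c S (fun b => Complex.exp (-(κ * (χ (bpos b) : ℂ))) • A b) y -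
        Complex.exp (κ * (χ y : ℂ)) • covDiv c S' (fun b => Complex.exp (-(κ * (χ (bpos b) : ℂ))) • A b) y‖ ≤
      ‖c‖ * Real.exp (‖κ‖ * θ) * δT * ∑ μ, ‖A (unshift μ y, μ)‖ := by
  rw [conj_covDiv_sub_covDiv_apply (fun x => Complex.exp (κ * (χ x : ℂ))) (fun x => Complex.exp (-(κ * (χ x : ℂ)))) c S S' A y, norm_smul,
    Finset.mul_sum]
  have hterm : ∀ μ : Fin d, ‖(Complex.exp (κ * (χ y : ℂ)) * Complex.exp (-(κ * (χ (unshift μ y) : ℂ)))) •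
      (S (unshift μ y, μ) - S' (unshift μ y, μ)) (A (unshift μ y, μ))‖ ≤ Real.exp (‖κ‖ * θ) * δT * ‖A (unshift μ y, μ)‖ := fun μ => by
    rw [exp_mul_exp_neg_eq_exp_sub, norm_smul, LinearMap.sub_apply]
    have hinc : |χ y - χ (unshift μ y)| ≤ θ := by
      rw [abs_sub_comm]
      have h := hχ (unshift μ y, μ)
      simp only [bpos, btgt, shift_unshift] at h
      exact h
    have h1 : ‖Complex.exp (κ * ((χ y - χ (unshift μ y) : ℝ) : ℂ))‖ ≤ Real.exp (‖κ‖ * θ) := norm_exp_mul_le_of_abs_le κ hinc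
    calc _ ≤ Real.exp (‖κ‖ * θ) * (δT * ‖A (unshift μ y, μ)‖) := mul_le_mul h1 (hSS' _ _) (norm_nonneg _) (Real.exp_pos _).le
      _ = Real.exp (‖κ‖ * θ) * δT * ‖A (unshift μ y, μ)‖ := by ring
  calc ‖c‖ * ‖∑ μ, (Complex.exp (κ * (χ y : ℂ)) * Complex.exp (-(κ * (χ (unshift μ y) : ℂ)))) • (S (unshift μ y, μ) - S' (unshift μ y, μ)) (A (unshift μ y, μ))‖
      ≤ ‖c‖ * ∑ μ, Real.exp (‖κ‖ * θ) * δT * ‖A (unshift μ y, μ)‖ :=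
        mul_le_mul_of_nonneg_left ((norm_sum_le _ _).trans (Finset.sum_le_sum fun μ _ => hterm μ)) (norm_nonneg c)
    _ = ∑ μ, ‖c‖ * Real.exp (‖κ‖ * θ) * δT * ‖A (unshift μ y, μ)‖ := by
        rw [Finset.mul_sum]; exact Finset.sum_congr rfl fun μ _ => by ring

/-- **`ℓ²` BOUND, function level:** `Σ_y ‖e^{κχ}((D*_S − D*_{S′})(e^{−κχ}A))(y)‖² ≤ (‖c‖e^{‖κ‖θ}δ_T)²·d·Σ_b ‖A(b)‖²` (Cauchy–Schwarz over the `d`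
directions, then the bond count). [folklore] [cite: Balaban1985BackgroundPropagators, (3.49) p.399, (3.8) p.392, (3.70)–(3.73) pp.404–405] -/
theorem sum_norm_sq_conjExp_covDiv_sub_covDiv_le {θ δT : ℝ} {S S' : Bond d Pd → V →ₗ[ℂ] V} (hSS' : ∀ b v, ‖S b v - S' b v‖ ≤ δT * ‖v‖) (κ : ℂ)
    {χ : TSite d Pd → ℝ} (hχ : ∀ b : Bond d Pd, |χ (bpos b) - χ (btgt b)| ≤ θ) (c : ℂ) (A : Bond d Pd → V) :
    ∑ y : TSite d Pd, ‖Complex.exp (κ * (χ y : ℂ)) • covDiv c S (fun b => Complex.exp (-(κ * (χ (bpos b) : ℂ))) • A b) y -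
        Complex.exp (κ * (χ y : ℂ)) • covDiv c S' (fun b => Complex.exp (-(κ * (χ (bpos b) : ℂ))) • A b) y‖ ^ 2
      ≤ (‖c‖ * Real.exp (‖κ‖ * θ) * δT) ^ 2 * d * ∑ b : Bond d Pd, ‖A b‖ ^ 2 := by
  set K : ℝ := ‖c‖ * Real.exp (‖κ‖ * θ) * δT with hK
  have hpt : ∀ y : TSite d Pd, ‖Complex.exp (κ * (χ y : ℂ)) • covDiv c S (fun b => Complex.exp (-(κ * (χ (bpos b) : ℂ))) • A b) y -
      Complex.exp (κ * (χ y : ℂ)) • covDiv c S' (fun b => Complex.exp (-(κ * (χ (bpos b) : ℂ))) • A b) y‖ ^ 2 ≤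
      K ^ 2 * (d * ∑ μ, ‖A (unshift μ y, μ)‖ ^ 2) := fun y => by
    have h := norm_conjExp_covDiv_sub_covDiv_apply_le hSS' κ hχ c A y
    have hcs : (∑ μ, ‖A (unshift μ y, μ)‖) ^ 2 ≤ d * ∑ μ, ‖A (unshift μ y, μ)‖ ^ 2 := by
      have h := sq_sum_le_card_mul_sum_sq (s := Finset.univ) (f := fun μ : Fin d => ‖A (unshift μ y, μ)‖)
      rwa [Finset.card_univ, Fintype.card_fin] at h
    calc _ ≤ (K * ∑ μ, ‖A (unshift μ y, μ)‖) ^ 2 := pow_le_pow_left₀ (norm_nonneg _) h 2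
      _ = K ^ 2 * (∑ μ, ‖A (unshift μ y, μ)‖) ^ 2 := by ring
      _ ≤ K ^ 2 * (d * ∑ μ, ‖A (unshift μ y, μ)‖ ^ 2) := mul_le_mul_of_nonneg_left hcs (sq_nonneg K)
  calc _ ≤ ∑ y : TSite d Pd, K ^ 2 * (d * ∑ μ, ‖A (unshift μ y, μ)‖ ^ 2) := Finset.sum_le_sum fun y _ => hpt y
    _ = K ^ 2 * d * ∑ y : TSite d Pd, ∑ μ, ‖A (unshift μ y, μ)‖ ^ 2 := by rw [mul_sum]; exact Finset.sum_congr rfl fun y _ => by ring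
    _ = K ^ 2 * d * ∑ b : Bond d Pd, ‖A b‖ ^ 2 := by rw [sum_site_unshift_eq (fun b => ‖A b‖ ^ 2)]

end Div

/-! ## §3 The letters on the weighted `L²` carriers, for abstract multiplication maps -/

section L2

variable {d : ℕ} {Pd : Fin d → ℕ} {V : Type*} [NormedAddCommGroup V] [InnerProductSpace ℂ V] {c₀ : ℝ} [Fact (0 < c₀)]

/-- **THE CONJUGATED TWO-BACKGROUND CURL LETTER** for ANY maps `S_P` (plaquette carrier, acting as `e^{κχ(p₀)}`) and `S_B⁻¹` (bond carrier, acting as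
`e^{−κχ(b₋)}`), transporter data `‖R(b)v − R′(b)v‖ ≤ δ_T‖v‖` (`0 ≤ δ_T`) and bond increments `|χ(b₋) − χ(b₊)| ≤ θ`:
`‖S_P(curl_R(S_B⁻¹A)) − S_P(curl_{R′}(S_B⁻¹A))‖ ≤ 2‖c‖·e^{‖κ‖θ}·δ_T·d·‖A‖` — the `δ₁`-letter (`tB₁`) of `B9Eq326ConjugatedDeltaATwoBackgrounds.norm_conjGk_sub_conjGk_le`
at the lattice, NO window on `κ`. [folklore] [cite: Balaban1985BackgroundPropagators, (3.49) p.399, (3.4) p.391, (3.52)–(3.53) p.400, (3.70)–(3.73) pp.404–405] -/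
theorem norm_mulOp_covCurlL2K_sub_covCurlL2K_le {θ δT : ℝ} (hδT : 0 ≤ δT) {R R' : Bond d Pd → V →ₗ[ℂ] V} (hRR' : ∀ b v, ‖R b v - R' b v‖ ≤ δT * ‖v‖)
    {κ : ℂ} {χ : TSite d Pd → ℝ} (hχ : ∀ b : Bond d Pd, |χ (bpos b) - χ (btgt b)| ≤ θ) (c : ℂ)
    (SP : PlaqL2K ℂ d Pd c₀ V → PlaqL2K ℂ d Pd c₀ V)
    (hSP : ∀ (F : PlaqL2K ℂ d Pd c₀ V) (p : B9SectCLatticeCarrier.Plaq d Pd),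
      WL2.equiv ℂ (fun _ : B9SectCLatticeCarrier.Plaq d Pd => c₀) V (SP F) p = Complex.exp (κ * (χ p.1 : ℂ)) • WL2.equiv ℂ (fun _ : B9SectCLatticeCarrier.Plaq d Pd => c₀) V F p)
    (SBinv : BondL2K ℂ d Pd c₀ V → BondL2K ℂ d Pd c₀ V)
    (hSBinv : ∀ (A : BondL2K ℂ d Pd c₀ V) (b : Bond d Pd),
      WL2.equiv ℂ (fun _ : Bond d Pd => c₀) V (SBinv A) b = Complex.exp (-(κ * (χ (bpos b) : ℂ))) • WL2.equiv ℂ (fun _ : Bond d Pd => c₀) V A b)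
    (A : BondL2K ℂ d Pd c₀ V) :
    ‖SP (covCurlL2K ℂ c₀ c R (SBinv A)) - SP (covCurlL2K ℂ c₀ c R' (SBinv A))‖ ≤ 2 * ‖c‖ * Real.exp (‖κ‖ * θ) * δT * d * ‖A‖ := by
  set K : ℝ := ‖c‖ * Real.exp (‖κ‖ * θ) * δT with hK
  have hK0 : 0 ≤ K := by positivity
  have hc₀ : 0 < c₀ := Fact.out
  set B : Bond d Pd → V := WL2.equiv ℂ (fun _ : Bond d Pd => c₀) V A with hB
  have hsum := sum_norm_sq_conjExp_covCurl_sub_covCurl_le hRR' κ hχ c B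
  have e : ∀ p : B9SectCLatticeCarrier.Plaq d Pd,
      WL2.equiv ℂ (fun _ : B9SectCLatticeCarrier.Plaq d Pd => c₀) V (SP (covCurlL2K ℂ c₀ c R (SBinv A)) - SP (covCurlL2K ℂ c₀ c R' (SBinv A))) p =
        Complex.exp (κ * (χ p.1 : ℂ)) • covCurl c R (fun b => Complex.exp (-(κ * (χ (bpos b) : ℂ))) • B b) p -
          Complex.exp (κ * (χ p.1 : ℂ)) • covCurl c R' (fun b => Complex.exp (-(κ * (χ (bpos b) : ℂ))) • B b) p := by
    intro p
    have hb : (WL2.equiv ℂ (fun _ : Bond d Pd => c₀) V (SBinv A)) = fun b => Complex.exp (-(κ * (χ (bpos b) : ℂ))) • B b := funext fun b => hSBinv A b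
    rw [WL2.equiv_sub, Pi.sub_apply, hSP, hSP, equiv_covCurlL2K, equiv_covCurlL2K, hb]
  have hsq : ‖SP (covCurlL2K ℂ c₀ c R (SBinv A)) - SP (covCurlL2K ℂ c₀ c R' (SBinv A))‖ ^ 2 ≤ (2 * K * d * ‖A‖) ^ 2 := by
    rw [WL2.norm_sq, mul_pow, mul_pow, mul_pow, WL2.norm_sq A]
    simp only [e]
    rw [← mul_sum, ← mul_sum]
    calc c₀ * ∑ p : B9SectCLatticeCarrier.Plaq d Pd, ‖Complex.exp (κ * (χ p.1 : ℂ)) • covCurl c R (fun b => Complex.exp (-(κ * (χ (bpos b) : ℂ))) • B b) p -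
            Complex.exp (κ * (χ p.1 : ℂ)) • covCurl c R' (fun b => Complex.exp (-(κ * (χ (bpos b) : ℂ))) • B b) p‖ ^ 2
        ≤ c₀ * (4 * K ^ 2 * (d : ℝ) ^ 2 * ∑ b, ‖B b‖ ^ 2) := mul_le_mul_of_nonneg_left hsum hc₀.le
      _ = 2 ^ 2 * K ^ 2 * (d : ℝ) ^ 2 * (c₀ * ∑ b, ‖B b‖ ^ 2) := by ring
  have hR0 : 0 ≤ 2 * K * d * ‖A‖ := by positivity
  calc _ ≤ 2 * K * d * ‖A‖ := (pow_le_pow_iff_left₀ (norm_nonneg _) hR0 two_ne_zero).1 hsq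
    _ = 2 * ‖c‖ * Real.exp (‖κ‖ * θ) * δT * d * ‖A‖ := by rw [hK]; ring

/-- **THE CONJUGATED TWO-BACKGROUND DIVERGENCE LETTER** for ANY maps `S_S` (site carrier, `e^{κχ(y)}`) and `S_B⁻¹` (bond carrier, `e^{−κχ(b₋)}`):
`‖S_S(D*_S(S_B⁻¹A)) − S_S(D*_{S′}(S_B⁻¹A))‖ ≤ ‖c‖·e^{‖κ‖θ}·δ_T·√d·‖A‖` — the `δ₂`-letter (`tB₂`) of `…norm_conjGk_sub_conjGk_le` at the lattice, NO window.
[folklore] [cite: Balaban1985BackgroundPropagators, (3.49) p.399, (3.8) p.392, (3.52)–(3.53) p.400, (3.70)–(3.73) pp.404–405] -/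
theorem norm_mulOp_covDivL2K_sub_covDivL2K_le {θ δT : ℝ} (hδT : 0 ≤ δT) {S S' : Bond d Pd → V →ₗ[ℂ] V} (hSS' : ∀ b v, ‖S b v - S' b v‖ ≤ δT * ‖v‖)
    {κ : ℂ} {χ : TSite d Pd → ℝ} (hχ : ∀ b : Bond d Pd, |χ (bpos b) - χ (btgt b)| ≤ θ) (c : ℂ)
    (SS : SiteL2K ℂ d Pd c₀ V → SiteL2K ℂ d Pd c₀ V)
    (hSS : ∀ (f : SiteL2K ℂ d Pd c₀ V) (y : TSite d Pd),
      WL2.equiv ℂ (fun _ : TSite d Pd => c₀) V (SS f) y = Complex.exp (κ * (χ y : ℂ)) • WL2.equiv ℂ (fun _ : TSite d Pd => c₀) V f y)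
    (SBinv : BondL2K ℂ d Pd c₀ V → BondL2K ℂ d Pd c₀ V)
    (hSBinv : ∀ (A : BondL2K ℂ d Pd c₀ V) (b : Bond d Pd),
      WL2.equiv ℂ (fun _ : Bond d Pd => c₀) V (SBinv A) b = Complex.exp (-(κ * (χ (bpos b) : ℂ))) • WL2.equiv ℂ (fun _ : Bond d Pd => c₀) V A b)
    (A : BondL2K ℂ d Pd c₀ V) :
    ‖SS (covDivL2K ℂ c₀ c S (SBinv A)) - SS (covDivL2K ℂ c₀ c S' (SBinv A))‖ ≤ ‖c‖ * Real.exp (‖κ‖ * θ) * δT * Real.sqrt d * ‖A‖ := by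
  set K : ℝ := ‖c‖ * Real.exp (‖κ‖ * θ) * δT with hK
  have hK0 : 0 ≤ K := by positivity
  have hc₀ : 0 < c₀ := Fact.out
  set B : Bond d Pd → V := WL2.equiv ℂ (fun _ : Bond d Pd => c₀) V A with hB
  have hsum := sum_norm_sq_conjExp_covDiv_sub_covDiv_le hSS' κ hχ c B
  have e : ∀ y : TSite d Pd,
      WL2.equiv ℂ (fun _ : TSite d Pd => c₀) V (SS (covDivL2K ℂ c₀ c S (SBinv A)) - SS (covDivL2K ℂ c₀ c S' (SBinv A))) y =
        Complex.exp (κ * (χ y : ℂ)) • covDiv c S (fun b => Complex.exp (-(κ * (χ (bpos b) : ℂ))) • B b) y -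
          Complex.exp (κ * (χ y : ℂ)) • covDiv c S' (fun b => Complex.exp (-(κ * (χ (bpos b) : ℂ))) • B b) y := by
    intro y
    have hb : (WL2.equiv ℂ (fun _ : Bond d Pd => c₀) V (SBinv A)) = fun b => Complex.exp (-(κ * (χ (bpos b) : ℂ))) • B b := funext fun b => hSBinv A b
    rw [WL2.equiv_sub, Pi.sub_apply, hSS, hSS, equiv_covDivL2K, equiv_covDivL2K, hb]
  have hsq : ‖SS (covDivL2K ℂ c₀ c S (SBinv A)) - SS (covDivL2K ℂ c₀ c S' (SBinv A))‖ ^ 2 ≤ (K * Real.sqrt d * ‖A‖) ^ 2 := by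
    rw [WL2.norm_sq, mul_pow, mul_pow, Real.sq_sqrt (Nat.cast_nonneg d), WL2.norm_sq A]
    simp only [e]
    rw [← mul_sum, ← mul_sum]
    calc c₀ * ∑ y : TSite d Pd, ‖Complex.exp (κ * (χ y : ℂ)) • covDiv c S (fun b => Complex.exp (-(κ * (χ (bpos b) : ℂ))) • B b) y -
            Complex.exp (κ * (χ y : ℂ)) • covDiv c S' (fun b => Complex.exp (-(κ * (χ (bpos b) : ℂ))) • B b) y‖ ^ 2
        ≤ c₀ * (K ^ 2 * d * ∑ b, ‖B b‖ ^ 2) := mul_le_mul_of_nonneg_left hsum hc₀.le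
      _ = K ^ 2 * d * (c₀ * ∑ b, ‖B b‖ ^ 2) := by ring
  have hR0 : 0 ≤ K * Real.sqrt d * ‖A‖ := by positivity
  calc _ ≤ K * Real.sqrt d * ‖A‖ := (pow_le_pow_iff_left₀ (norm_nonneg _) hR0 two_ne_zero).1 hsq
    _ = ‖c‖ * Real.exp (‖κ‖ * θ) * δT * Real.sqrt d * ‖A‖ := by rw [hK]

end L2

end Literature.MathematicalPhysics.QuantumFieldTheory.Balaban1983to89.B9Eq3101ConjugationLettersTwoBackgrounds

end
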